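import Summits.CriticalPhenomena.SAWScalingLimit.Theses.SAWDevelopingMap
import Summits.CriticalPhenomena.SAWScalingLimit.Theorems.SAWDevelopingMapInteriorFlatteningLiouvilleEquivalence
import Summits.CriticalPhenomena.SAWScalingLimit.Theorems.SAWDevelopingMapInteriorFlatteningLiouvillePromotion
import Summits.CriticalPhenomena.SAWScalingLimit.Theorems.SAWDevelopingMapInteriorFlatteningLiouvilleBulkNoFoldSlit
import Summits.CriticalPhenomena.SAWScalingLimit.Theorems.SAWDevelopingMapInteriorFlatteningLiouvillePicSubLocal

/-!
# Line `exact-split` for the crux `InteriorFlattening` (stmt-CriticalPhenomena-8297) — redirect strategist r1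

STATE r1 (2026-08-17, seat `planner-cstrat-stmt-CriticalPhenomena-8297-r1-0`). This skeleton is the PLAN OF RECORD of the
route-level DECOMPOSITION of the crux (D-0019 glued split filed by this seat):

  `InteriorFlattening ⟺ BulkNoFold ∧ LocalLimitsUnique`   (both directions landed: …LiouvilleEquivalence, p115301)

Its two registered stubs are the two CHILDREN verbatim, in ROUTE VOCABULARY (the texts filed in `children.json`; each is
`Iff.rfl` the Defs-side statement `∃ k R₀, 0 ≤ k ∧ k < 1 ∧ RatioAtDepth R₀ k` / `LocalLimits.Subsingleton`), and the
composition `InteriorFlattening_of` is the landed sufficiency theorem — so the registered stub set IS the split family and the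
assembly over the stub signatures is a theorem, not a seam to be proved later. It supersedes, as top layer, the registered
skeleton r10 of the dead line `liouville-local-limits` (whose top stub S5* was the CONDITIONAL form
`∀ k R₀, … RatioAtDepth R₀ k → LocalLimits.Subsingleton`, kernel-checked `↔ (BulkNoFold → crux)`): here the Liouville half is
filed UNCONDITIONALLY, so that neither stub is the crux conditioned on the other.

* `stub_bulkNoFold`        — CHILD 1 `BulkNoFold`: eventual bulk no-fold (∃ k < 1, ∃ R₀; finite-depth, quantitative, falsifiable by
  one exact configuration; ⇐ NoFoldBound stmt-8296 by `bulkNoFold_of_noFoldBound`; ⟺ deep slit coherence,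
  `bulkNoFold_iff_deepSlitCoherence`). OPEN.
* `stub_localLimitsUnique` — CHILD 2 `LocalLimitsUnique`: all lattice-scale local limits of `M(O)`-normalised observables coincide
  (Liouville half; DCS 2012 orientation-independence, arXiv:1007.0575 p. 7). OPEN, conjecture-grade.
* `InteriorFlattening_of`  — stub₁ → stub₂ → crux BY NAME (= `interiorFlattening_of_bulkNoFold_of_subsingleton`, p115301).
* `subs_of_InteriorFlattening`, `InteriorFlattening_iff_stubs` — the split is EXACT (both children necessary).
* Probes (this seat, `bc/Probe_min.lean`, `bc/Probe_min2.lean`, `bc/Probe_strong.lean`, `bc/BC7.lean`; farm, 400 000 heartbeats):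
  stub₁ → crux FAIL, stub₁ → SAWScalingLimit FAIL, stub₂ → crux FAIL, stub₂ → SAWScalingLimit FAIL (minimal AND full-cone imports);
  crux → stubᵢ SUCCEED (necessity, `exact?`); SAWScalingLimit → stubᵢ FAIL; NoFoldBound → stub₂ FAIL; BC7 `#h21_crux_probe`: both CLEAN.

Sorries: exactly the two `stub_*`. Everything else kernel-checked against the landed Liouville cone.
-/

noncomputable section

open scoped BigOperators Topology
open Filter

namespace Summit.CriticalPhenomena.SAWScalingLimit.Cruxes.InteriorFlattening.ExactSplit

open Summit.CriticalPhenomena.SAWScalingLimit.Theorems.InteriorFlattening.Liouville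

/-- **stub 1 = CHILD 1 `BulkNoFold`** (route vocabulary; OPEN): eventual bulk no-fold — some `k < 1` bounds the Beltrami
quotient `‖F₀ + ωF₁ + ω²F₂‖ / ‖F₀ + F₁ + F₂‖` at every `R₀`-deep vertex of every simply connected domain with a boundary root,
in every frame. Why plausibly true: numerically the sup quotient at depth `R` decays `0.683 R^{-0.76}` (balls to `R = 96`), far-field
amplification `≤ 1.09`; implied by the rank-2 crux `NoFoldBound`. Size: open-problem (rooted critical-SAP inequality at deep slit
tips + first-arrival phase coherence, `bulkNoFold_iff_deepSlitCoherence`). -/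
theorem stub_bulkNoFold :
    ∃ k R₀ : ℝ, 0 ≤ k ∧ k < 1 ∧ ∀ (Λ : Finset Literature.Probability.LatticeModels.HexVertex),
      Literature.Probability.RandomPlanarGeometry.SAW.hexDomainSimplyConnected Λ →
      ∀ a ∈ Literature.Probability.RandomPlanarGeometry.SAW.hexDomainBoundary Λ, ∀ v ∈ Λ,
        (∀ w : Literature.Probability.LatticeModels.HexVertex,
          dist (Literature.Probability.LatticeModels.hexCenter w) (Literature.Probability.LatticeModels.hexCenter v) ≤ R₀ →
            w ∈ Λ) →
        ∀ w₀ w₁ w₂ : Literature.Probability.LatticeModels.HexVertex,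
          Literature.Probability.LatticeModels.hexGraph.Adj v w₀ → Literature.Probability.LatticeModels.hexGraph.Adj v w₁ →
          Literature.Probability.LatticeModels.hexGraph.Adj v w₂ → w₀ ≠ w₁ → w₁ ≠ w₂ → w₀ ≠ w₂ →
            let F : Sym2 Literature.Probability.LatticeModels.HexVertex → ℂ :=
              Literature.Probability.RandomPlanarGeometry.SAW.hexParafermionicObservable Λ a
                Literature.Probability.RandomPlanarGeometry.SAW.hexCriticalFugacity (5 / 8)
            let ω : ℂ := Complex.exp (2 * Real.pi * Complex.I / 3)
            ‖F s(v, w₀) + ω * F s(v, w₁) + ω ^ 2 * F s(v, w₂)‖ ≤ k * ‖F s(v, w₀) + F s(v, w₁) + F s(v, w₂)‖ := by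
  sorry

/-- **stub 2 = CHILD 2 `LocalLimitsUnique`** (route vocabulary; OPEN, conjecture-grade): the class of lattice-scale local
limits at the origin vertex `O` of `M(O)`-normalised observables of admissible configurations (simply connected, boundary
root, `O` `n`-deep, `M ≠ 0`) has at most one element. Why plausibly true: it is DCS's expected orientation-independence of
`F_δ` in Liouville form; numerically every probed family flattens (balls, strips `μ_∞(H) ≍ H^{-0.72}`, 2 400 designed far
fields). Size: open-problem (far-field independence / spreading of the first-arrival turning law; no theorem in print). -/
theorem stub_localLimitsUnique :
    let O : Literature.Probability.LatticeModels.HexVertex :=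
        ((0 : Literature.Probability.LatticeModels.Site 2), (0 : Fin 2))
    let A : Literature.Probability.LatticeModels.HexVertex :=
        ((0 : Literature.Probability.LatticeModels.Site 2), (1 : Fin 2))
    let B : Literature.Probability.LatticeModels.HexVertex :=
        ((-(Pi.single 0 1) : Literature.Probability.LatticeModels.Site 2), (1 : Fin 2))
    let C : Literature.Probability.LatticeModels.HexVertex :=
        ((-(Pi.single 1 1) : Literature.Probability.LatticeModels.Site 2), (1 : Fin 2))
    let F : Finset Literature.Probability.LatticeModels.HexVertex →
        Sym2 Literature.Probability.LatticeModels.HexVertex →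
          Sym2 Literature.Probability.LatticeModels.HexVertex → ℂ :=
      fun Λ a z => Literature.Probability.RandomPlanarGeometry.SAW.hexParafermionicObservable Λ a
        Literature.Probability.RandomPlanarGeometry.SAW.hexCriticalFugacity (5 / 8) z
    let M : Finset Literature.Probability.LatticeModels.HexVertex →
        Sym2 Literature.Probability.LatticeModels.HexVertex → ℂ :=
      fun Λ a => F Λ a s(O, A) + F Λ a s(O, B) + F Λ a s(O, C)
    let LocalLimits : Set (Sym2 Literature.Probability.LatticeModels.HexVertex → ℂ) :=
      {G | (∀ z : Sym2 Literature.Probability.LatticeModels.HexVertex,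
            z ∉ Literature.Probability.LatticeModels.hexGraph.edgeSet → G z = 0) ∧
          ∃ (Λ : ℕ → Finset Literature.Probability.LatticeModels.HexVertex)
            (a : ℕ → Sym2 Literature.Probability.LatticeModels.HexVertex),
            (∀ n : ℕ, Literature.Probability.RandomPlanarGeometry.SAW.hexDomainSimplyConnected (Λ n) ∧
              a n ∈ Literature.Probability.RandomPlanarGeometry.SAW.hexDomainBoundary (Λ n) ∧
              ∀ w : Literature.Probability.LatticeModels.HexVertex,
                dist (Literature.Probability.LatticeModels.hexCenter w)
                  (Literature.Probability.LatticeModels.hexCenter O) ≤ (n : ℝ) → w ∈ Λ n) ∧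
            (∀ n : ℕ, M (Λ n) (a n) ≠ 0) ∧
            ∀ z ∈ Literature.Probability.LatticeModels.hexGraph.edgeSet,
              Filter.Tendsto (fun n : ℕ => F (Λ n) (a n) z / M (Λ n) (a n)) Filter.atTop (nhds (G z))}
    LocalLimits.Subsingleton := by
  sorry

/-- stub 1 is definitionally the Defs-side bulk no-fold. -/
theorem stub_bulkNoFold_iff_defs :
    (∃ k R₀ : ℝ, 0 ≤ k ∧ k < 1 ∧ ∀ (Λ : Finset Literature.Probability.LatticeModels.HexVertex), Literature.Probability.RandomPlanarGeometry.SAW.hexDomainSimplyConnected Λ → ∀ a ∈ Literature.Probability.RandomPlanarGeometry.SAW.hexDomainBoundary Λ, ∀ v ∈ Λ, (∀ w : Literature.Probability.LatticeModels.HexVertex, dist (Literature.Probability.LatticeModels.hexCenter w) (Literature.Probability.LatticeModels.hexCenter v) ≤ R₀ → w ∈ Λ) → ∀ w₀ w₁ w₂ : Literature.Probability.LatticeModels.HexVertex, Literature.Probability.LatticeModels.hexGraph.Adj v w₀ → Literature.Probability.LatticeModels.hexGraph.Adj v w₁ → Literature.Probability.LatticeModels.hexGraph.Adj v w₂ → w₀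 ≠ w₁ → w₁ ≠ w₂ → w₀ ≠ w₂ → let F : Sym2 Literature.Probability.LatticeModels.HexVertex → ℂ := Literature.Probability.RandomPlanarGeometry.SAW.hexParafermionicObservable Λ a Literature.Probability.RandomPlanarGeometry.SAW.hexCriticalFugacity (5 / 8); let ω : ℂ := Complex.exp (2 * Real.pi * Complex.I / 3); ‖F s(v, w₀) + ω * F s(v, w₁) + ω ^ 2 * F s(v, w₂)‖ ≤ k * ‖F s(v, w₀) + F s(v, w₁) + F s(v, w₂)‖) ↔ (∃ k R₀ : ℝ, 0 ≤ k ∧ k < 1 ∧ RatioAtDepth R₀ k) :=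
  Iff.rfl

/-- stub 2 is definitionally `LocalLimits.Subsingleton`. -/
theorem stub_localLimitsUnique_iff_defs :
    (let O : Literature.Probability.LatticeModels.HexVertex := ((0 : Literature.Probability.LatticeModels.Site 2), (0 : Fin 2)); let A : Literature.Probability.LatticeModels.HexVertex := ((0 : Literature.Probability.LatticeModels.Site 2), (1 : Fin 2)); let B : Literature.Probability.LatticeModels.HexVertex := ((-(Pi.single 0 1) : Literature.Probability.LatticeModels.Site 2), (1 : Fin 2)); let C : Literature.Probability.LatticeModels.HexVertex := ((-(Pi.single 1 1) : Literature.Probability.LatticeModels.Site 2), (1 : Fin 2)); let F : Finset Literature.Probability.LatticeModels.HexVertex → Sym2 Literature.Probability.LatticeModels.HexVertex → Sym2 Literature.Probability.LatticeModels.HexVertex → ℂ := fun Λ a z => Literature.Probability.RandomPlanarGeometry.SAW.hexParafermionicObservable Λ a Literature.Probability.RandomPlanarGeometry.SAW.hexCriticalFugacity (5 / 8) z; let M : Finset Literature.Probability.LatticeModels.HexVertex → Sym2 Literature.Probability.LatticeModels.HexVertex → ℂ := fun Λ a => F Λ a s(O, A) + F Λ a s(O, B) + F Λ a s(O, C); let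 LocalLimits : Set (Sym2 Literature.Probability.LatticeModels.HexVertex → ℂ) := {G | (∀ z : Sym2 Literature.Probability.LatticeModels.HexVertex, z ∉ Literature.Probability.LatticeModels.hexGraph.edgeSet → G z = 0) ∧ ∃ (Λ : ℕ → Finset Literature.Probability.LatticeModels.HexVertex) (a : ℕ → Sym2 Literature.Probability.LatticeModels.HexVertex), (∀ n : ℕ, Literature.Probability.RandomPlanarGeometry.SAW.hexDomainSimplyConnected (Λ n) ∧ a n ∈ Literature.Probability.RandomPlanarGeometry.SAW.hexDomainBoundary (Λ n) ∧ ∀ w : Literature.Probability.LatticeModels.HexVertex, dist (Literature.Probability.LatticeModels.hexCenter w) (Literature.Probability.LatticeModels.hexCenter O) ≤ (n : ℝ) → w ∈ Λ n) ∧ (∀ n : ℕ, M (Λ n) (a n) ≠ 0) ∧ ∀ z ∈ Literature.Probability.LatticeModels.hexGraph.edgeSet, Filter.Tendsto (fun n : ℕ => F (Λ n) (a n) z / M (Λ n) (a n)) Filter.atTop (nhds (G z))}; LocalLimits.Subsingleton) ↔ LocalLimits.Subsingleton :=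
  Iff.rfl

/-- **COMPOSITION — the line concludes the crux BY NAME**: stub₁ → stub₂ → `InteriorFlattening`
(the landed sufficiency `interiorFlattening_of_bulkNoFold_of_subsingleton`, p115301, read through the two `Iff.rfl`s). -/
theorem InteriorFlattening_of
    (h₁ : ∃ k R₀ : ℝ, 0 ≤ k ∧ k < 1 ∧ ∀ (Λ : Finset Literature.Probability.LatticeModels.HexVertex), Literature.Probability.RandomPlanarGeometry.SAW.hexDomainSimplyConnected Λ → ∀ a ∈ Literature.Probability.RandomPlanarGeometry.SAW.hexDomainBoundary Λ, ∀ v ∈ Λ, (∀ w : Literature.Probability.LatticeModels.HexVertex, dist (Literature.Probability.LatticeModels.hexCenter w) (Literature.Probability.LatticeModels.hexCenter v) ≤ R₀ → w ∈ Λ) → ∀ w₀ w₁ w₂ : Literature.Probability.LatticeModels.HexVertex, Literature.Probability.LatticeModels.hexGraph.Adj v w₀ → Literature.Probability.LatticeModels.hexGraph.Adj v w₁ → Literature.Probability.LatticeModels.hexGraph.Adj v w₂ → w₀ ≠ w₁ → w₁ ≠ w₂ → w₀ ≠ w₂ → let F : Sym2 Literature.Probability.LatticeModels.HexVertex → ℂ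 := Literature.Probability.RandomPlanarGeometry.SAW.hexParafermionicObservable Λ a Literature.Probability.RandomPlanarGeometry.SAW.hexCriticalFugacity (5 / 8); let ω : ℂ := Complex.exp (2 * Real.pi * Complex.I / 3); ‖F s(v, w₀) + ω * F s(v, w₁) + ω ^ 2 * F s(v, w₂)‖ ≤ k * ‖F s(v, w₀) + F s(v, w₁) + F s(v, w₂)‖)
    (h₂ : let O : Literature.Probability.LatticeModels.HexVertex := ((0 : Literature.Probability.LatticeModels.Site 2), (0 : Fin 2)); let A : Literature.Probability.LatticeModels.HexVertex := ((0 : Literature.Probability.LatticeModels.Site 2), (1 : Fin 2)); let B : Literature.Probability.LatticeModels.HexVertex := ((-(Pi.single 0 1) : Literature.Probability.LatticeModels.Site 2), (1 : Fin 2)); let C : Literature.Probability.LatticeModels.HexVertex := ((-(Pi.single 1 1) : Literature.Probability.LatticeModels.Site 2), (1 : Fin 2)); let F : Finset Literature.Probability.LatticeModels.HexVertex → Sym2 Literature.Probability.LatticeModels.HexVertex → Sym2 Literature.Probability.LatticeModels.HexVertex → ℂ := fun Λ a z => Literature.Probability.RandomPlanarGeometry.SAW.hexParafermionicObservable Λ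 a Literature.Probability.RandomPlanarGeometry.SAW.hexCriticalFugacity (5 / 8) z; let M : Finset Literature.Probability.LatticeModels.HexVertex → Sym2 Literature.Probability.LatticeModels.HexVertex → ℂ := fun Λ a => F Λ a s(O, A) + F Λ a s(O, B) + F Λ a s(O, C); let LocalLimits : Set (Sym2 Literature.Probability.LatticeModels.HexVertex → ℂ) := {G | (∀ z : Sym2 Literature.Probability.LatticeModels.HexVertex, z ∉ Literature.Probability.LatticeModels.hexGraph.edgeSet → G z = 0) ∧ ∃ (Λ : ℕ → Finset Literature.Probability.LatticeModels.HexVertex) (a : ℕ → Sym2 Literature.Probability.LatticeModels.HexVertex), (∀ n : ℕ, Literature.Probability.RandomPlanarGeometry.SAW.hexDomainSimplyConnected (Λ n) ∧ a n ∈ Literature.Probability.RandomPlanarGeometry.SAW.hexDomainBoundary (Λ n) ∧ ∀ w : Literature.Probability.LatticeModels.HexVertex, dist (Literature.Probability.LatticeModels.hexCenter w) (Literature.Probability.LatticeModels.hexCenter O) ≤ (n : ℝ) → w ∈ Λ n) ∧ (∀ n : ℕ, M (Λ n) (a n) ≠ 0) ∧ ∀ z ∈ Literature.Probability.LatticeModels.hexGraph.edgeSet,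 Filter.Tendsto (fun n : ℕ => F (Λ n) (a n) z / M (Λ n) (a n)) Filter.atTop (nhds (G z))}; LocalLimits.Subsingleton) :
    Summit.CriticalPhenomena.SAWScalingLimit.Theses.SAWDevelopingMap.InteriorFlattening :=
  interiorFlattening_of_bulkNoFold_of_subsingleton (stub_bulkNoFold_iff_defs.1 h₁) (stub_localLimitsUnique_iff_defs.1 h₂)

/-- **The split is exact**: the crux implies both stubs (children are NECESSARY). -/
theorem subs_of_InteriorFlattening
    (h : Summit.CriticalPhenomena.SAWScalingLimit.Theses.SAWDevelopingMap.InteriorFlattening) :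
    (∃ k R₀ : ℝ, 0 ≤ k ∧ k < 1 ∧ ∀ (Λ : Finset Literature.Probability.LatticeModels.HexVertex), Literature.Probability.RandomPlanarGeometry.SAW.hexDomainSimplyConnected Λ → ∀ a ∈ Literature.Probability.RandomPlanarGeometry.SAW.hexDomainBoundary Λ, ∀ v ∈ Λ, (∀ w : Literature.Probability.LatticeModels.HexVertex, dist (Literature.Probability.LatticeModels.hexCenter w) (Literature.Probability.LatticeModels.hexCenter v) ≤ R₀ → w ∈ Λ) → ∀ w₀ w₁ w₂ : Literature.Probability.LatticeModels.HexVertex, Literature.Probability.LatticeModels.hexGraph.Adj v w₀ → Literature.Probability.LatticeModels.hexGraph.Adj v w₁ → Literature.Probability.LatticeModels.hexGraph.Adj v w₂ → w₀ ≠ w₁ → w₁ ≠ w₂ → w₀ ≠ w₂ → let F : Sym2 Literature.Probability.LatticeModels.HexVertex → ℂ := Literature.Probability.RandomPlanarGeometry.SAW.hexParafermionicObservable Λ a Literature.Probability.RandomPlanarGeometry.SAW.hexCriticalFugacity (5 / 8); let ω : ℂ := Complex.exp (2 * Real.pi * Complex.I / 3); ‖F s(v, w₀) + ω * F s(v, w₁)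 + ω ^ 2 * F s(v, w₂)‖ ≤ k * ‖F s(v, w₀) + F s(v, w₁) + F s(v, w₂)‖) ∧ (let O : Literature.Probability.LatticeModels.HexVertex := ((0 : Literature.Probability.LatticeModels.Site 2), (0 : Fin 2)); let A : Literature.Probability.LatticeModels.HexVertex := ((0 : Literature.Probability.LatticeModels.Site 2), (1 : Fin 2)); let B : Literature.Probability.LatticeModels.HexVertex := ((-(Pi.single 0 1) : Literature.Probability.LatticeModels.Site 2), (1 : Fin 2)); let C : Literature.Probability.LatticeModels.HexVertex := ((-(Pi.single 1 1) : Literature.Probability.LatticeModels.Site 2), (1 : Fin 2)); let F : Finset Literature.Probability.LatticeModels.HexVertex → Sym2 Literature.Probability.LatticeModels.HexVertex → Sym2 Literature.Probability.LatticeModels.HexVertex → ℂ := fun Λ a z => Literature.Probability.RandomPlanarGeometry.SAW.hexParafermionicObservable Λ a Literature.Probability.RandomPlanarGeometry.SAW.hexCriticalFugacity (5 / 8) z; let M : Finset Literature.Probability.LatticeModels.HexVertex → Sym2 Literature.Probability.LatticeModels.HexVertex → ℂ := fun Λ a => F Λ a s(O, A) + F Λ a s(O, B) + F Λ a s(O,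 C); let LocalLimits : Set (Sym2 Literature.Probability.LatticeModels.HexVertex → ℂ) := {G | (∀ z : Sym2 Literature.Probability.LatticeModels.HexVertex, z ∉ Literature.Probability.LatticeModels.hexGraph.edgeSet → G z = 0) ∧ ∃ (Λ : ℕ → Finset Literature.Probability.LatticeModels.HexVertex) (a : ℕ → Sym2 Literature.Probability.LatticeModels.HexVertex), (∀ n : ℕ, Literature.Probability.RandomPlanarGeometry.SAW.hexDomainSimplyConnected (Λ n) ∧ a n ∈ Literature.Probability.RandomPlanarGeometry.SAW.hexDomainBoundary (Λ n) ∧ ∀ w : Literature.Probability.LatticeModels.HexVertex, dist (Literature.Probability.LatticeModels.hexCenter w) (Literature.Probability.LatticeModels.hexCenter O) ≤ (n : ℝ) → w ∈ Λ n) ∧ (∀ n : ℕ, M (Λ n) (a n) ≠ 0) ∧ ∀ z ∈ Literature.Probability.LatticeModels.hexGraph.edgeSet, Filter.Tendsto (fun n : ℕ => F (Λ n) (a n) z / M (Λ n) (a n)) Filter.atTop (nhds (G z))}; LocalLimits.Subsingleton) :=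
  ⟨stub_bulkNoFold_iff_defs.2 (BulkNoFold.bulkNoFold_of_interiorFlattening h),
    stub_localLimitsUnique_iff_defs.2 (localLimits_subsingleton_of_interiorFlattening h)⟩

/-- The crux is literally the conjunction of the two stub statements. -/
theorem InteriorFlattening_iff_stubs :
    Summit.CriticalPhenomena.SAWScalingLimit.Theses.SAWDevelopingMap.InteriorFlattening ↔ (∃ k R₀ : ℝ, 0 ≤ k ∧ k < 1 ∧ ∀ (Λ : Finset Literature.Probability.LatticeModels.HexVertex), Literature.Probability.RandomPlanarGeometry.SAW.hexDomainSimplyConnected Λ → ∀ a ∈ Literature.Probability.RandomPlanarGeometry.SAW.hexDomainBoundary Λ, ∀ v ∈ Λ, (∀ w : Literature.Probability.LatticeModels.HexVertex, dist (Literature.Probability.LatticeModels.hexCenter w) (Literature.Probability.LatticeModels.hexCenter v) ≤ R₀ → w ∈ Λ) → ∀ w₀ w₁ w₂ : Literature.Probability.LatticeModels.HexVertex, Literature.Probability.LatticeModels.hexGraph.Adj v w₀ → Literature.Probability.LatticeModels.hexGraph.Adj v w₁ → Literature.Probability.LatticeModels.hexGraph.Adj v w₂ → w₀ ≠ w₁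 → w₁ ≠ w₂ → w₀ ≠ w₂ → let F : Sym2 Literature.Probability.LatticeModels.HexVertex → ℂ := Literature.Probability.RandomPlanarGeometry.SAW.hexParafermionicObservable Λ a Literature.Probability.RandomPlanarGeometry.SAW.hexCriticalFugacity (5 / 8); let ω : ℂ := Complex.exp (2 * Real.pi * Complex.I / 3); ‖F s(v, w₀) + ω * F s(v, w₁) + ω ^ 2 * F s(v, w₂)‖ ≤ k * ‖F s(v, w₀) + F s(v, w₁) + F s(v, w₂)‖) ∧ (let O : Literature.Probability.LatticeModels.HexVertex := ((0 : Literature.Probability.LatticeModels.Site 2), (0 : Fin 2)); let A : Literature.Probability.LatticeModels.HexVertex := ((0 : Literature.Probability.LatticeModels.Site 2), (1 : Fin 2)); let B : Literature.Probability.LatticeModels.HexVertex := ((-(Pi.single 0 1) : Literature.Probability.LatticeModels.Site 2), (1 : Fin 2)); let C : Literature.Probability.LatticeModels.HexVertex := ((-(Pi.single 1 1) : Literature.Probability.LatticeModels.Site 2), (1 : Fin 2)); let F : Finset Literature.Probability.LatticeModels.HexVertex → Sym2 Literature.Probability.LatticeModels.HexVertex → Sym2 Literature.Probability.LatticeModels.HexVertex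 → ℂ := fun Λ a z => Literature.Probability.RandomPlanarGeometry.SAW.hexParafermionicObservable Λ a Literature.Probability.RandomPlanarGeometry.SAW.hexCriticalFugacity (5 / 8) z; let M : Finset Literature.Probability.LatticeModels.HexVertex → Sym2 Literature.Probability.LatticeModels.HexVertex → ℂ := fun Λ a => F Λ a s(O, A) + F Λ a s(O, B) + F Λ a s(O, C); let LocalLimits : Set (Sym2 Literature.Probability.LatticeModels.HexVertex → ℂ) := {G | (∀ z : Sym2 Literature.Probability.LatticeModels.HexVertex, z ∉ Literature.Probability.LatticeModels.hexGraph.edgeSet → G z = 0) ∧ ∃ (Λ : ℕ → Finset Literature.Probability.LatticeModels.HexVertex) (a : ℕ → Sym2 Literature.Probability.LatticeModels.HexVertex), (∀ n : ℕ, Literature.Probability.RandomPlanarGeometry.SAW.hexDomainSimplyConnected (Λ n) ∧ a n ∈ Literature.Probability.RandomPlanarGeometry.SAW.hexDomainBoundary (Λ n) ∧ ∀ w : Literature.Probability.LatticeModels.HexVertex, dist (Literature.Probability.LatticeModels.hexCenter w) (Literature.Probability.LatticeModels.hexCenter O) ≤ (n : ℝ) → w ∈ Λ n) ∧ (∀ n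 : ℕ, M (Λ n) (a n) ≠ 0) ∧ ∀ z ∈ Literature.Probability.LatticeModels.hexGraph.edgeSet, Filter.Tendsto (fun n : ℕ => F (Λ n) (a n) z / M (Λ n) (a n)) Filter.atTop (nhds (G z))}; LocalLimits.Subsingleton) :=
  ⟨subs_of_InteriorFlattening, fun h => InteriorFlattening_of h.1 h.2⟩

/-- stub 1 follows from the sibling crux `NoFoldBound` (stmt-CriticalPhenomena-8296). -/
theorem stub_bulkNoFold_of_noFoldBound
    (hK : Summit.CriticalPhenomena.SAWScalingLimit.Theses.SAWDevelopingMap.NoFoldBound) : (∃ k R₀ : ℝ, 0 ≤ k ∧ k < 1 ∧ ∀ (Λ : Finset Literature.Probability.LatticeModels.HexVertex), Literature.Probability.RandomPlanarGeometry.SAW.hexDomainSimplyConnected Λ → ∀ a ∈ Literature.Probability.RandomPlanarGeometry.SAW.hexDomainBoundary Λ, ∀ v ∈ Λ, (∀ w : Literature.Probability.LatticeModels.HexVertex, dist (Literature.Probability.LatticeModels.hexCenter w) (Literature.Probability.LatticeModels.hexCenter v) ≤ R₀ → w ∈ Λ) → ∀ w₀ w₁ w₂ : Literature.Probability.LatticeModels.HexVertex,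 Literature.Probability.LatticeModels.hexGraph.Adj v w₀ → Literature.Probability.LatticeModels.hexGraph.Adj v w₁ → Literature.Probability.LatticeModels.hexGraph.Adj v w₂ → w₀ ≠ w₁ → w₁ ≠ w₂ → w₀ ≠ w₂ → let F : Sym2 Literature.Probability.LatticeModels.HexVertex → ℂ := Literature.Probability.RandomPlanarGeometry.SAW.hexParafermionicObservable Λ a Literature.Probability.RandomPlanarGeometry.SAW.hexCriticalFugacity (5 / 8); let ω : ℂ := Complex.exp (2 * Real.pi * Complex.I / 3); ‖F s(v, w₀) + ω * F s(v, w₁) + ω ^ 2 * F s(v, w₂)‖ ≤ k * ‖F s(v, w₀) + F s(v, w₁) + F s(v, w₂)‖) :=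
  stub_bulkNoFold_iff_defs.2 (BulkNoFold.bulkNoFold_of_noFoldBound hK)

/-- Under stub 1, stub 2 is EQUIVALENT to the crux (so the analytic difficulty sits in stub 2 once the no-fold normalisation is
available; without stub 1 no implication stub 2 → crux is known). -/
theorem stub_localLimitsUnique_iff_crux_of_stub_bulkNoFold (h₁ : ∃ k R₀ : ℝ, 0 ≤ k ∧ k < 1 ∧ ∀ (Λ : Finset Literature.Probability.LatticeModels.HexVertex), Literature.Probability.RandomPlanarGeometry.SAW.hexDomainSimplyConnected Λ → ∀ a ∈ Literature.Probability.RandomPlanarGeometry.SAW.hexDomainBoundary Λ, ∀ v ∈ Λ, (∀ w : Literature.Probability.LatticeModels.HexVertex, dist (Literature.Probability.LatticeModels.hexCenter w) (Literature.Probability.LatticeModels.hexCenter v) ≤ R₀ → w ∈ Λ) → ∀ w₀ w₁ w₂ : Literature.Probability.LatticeModels.HexVertex, Literature.Probability.LatticeModels.hexGraph.Adj v w₀ → Literature.Probability.LatticeModels.hexGraph.Adj v w₁ → Literature.Probability.LatticeModels.hexGraph.Adj v w₂ → w₀ ≠ w₁ → w₁ ≠ w₂ → w₀ ≠ w₂ →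 let F : Sym2 Literature.Probability.LatticeModels.HexVertex → ℂ := Literature.Probability.RandomPlanarGeometry.SAW.hexParafermionicObservable Λ a Literature.Probability.RandomPlanarGeometry.SAW.hexCriticalFugacity (5 / 8); let ω : ℂ := Complex.exp (2 * Real.pi * Complex.I / 3); ‖F s(v, w₀) + ω * F s(v, w₁) + ω ^ 2 * F s(v, w₂)‖ ≤ k * ‖F s(v, w₀) + F s(v, w₁) + F s(v, w₂)‖) :
    (let O : Literature.Probability.LatticeModels.HexVertex := ((0 : Literature.Probability.LatticeModels.Site 2), (0 : Fin 2)); let A : Literature.Probability.LatticeModels.HexVertex := ((0 : Literature.Probability.LatticeModels.Site 2), (1 : Fin 2)); let B : Literature.Probability.LatticeModels.HexVertex := ((-(Pi.single 0 1) : Literature.Probability.LatticeModels.Site 2), (1 : Fin 2)); let C : Literature.Probability.LatticeModels.HexVertex := ((-(Pi.single 1 1) : Literature.Probability.LatticeModels.Site 2), (1 : Fin 2)); let F : Finset Literature.Probability.LatticeModels.HexVertex → Sym2 Literature.Probability.LatticeModels.HexVertex → Sym2 Literature.Probability.LatticeModels.HexVertex → ℂ := fun Λ a z => Literature.Probability.RandomPlanarGeometry.SAW.hexParafermionicObservable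 Λ a Literature.Probability.RandomPlanarGeometry.SAW.hexCriticalFugacity (5 / 8) z; let M : Finset Literature.Probability.LatticeModels.HexVertex → Sym2 Literature.Probability.LatticeModels.HexVertex → ℂ := fun Λ a => F Λ a s(O, A) + F Λ a s(O, B) + F Λ a s(O, C); let LocalLimits : Set (Sym2 Literature.Probability.LatticeModels.HexVertex → ℂ) := {G | (∀ z : Sym2 Literature.Probability.LatticeModels.HexVertex, z ∉ Literature.Probability.LatticeModels.hexGraph.edgeSet → G z = 0) ∧ ∃ (Λ : ℕ → Finset Literature.Probability.LatticeModels.HexVertex) (a : ℕ → Sym2 Literature.Probability.LatticeModels.HexVertex), (∀ n : ℕ, Literature.Probability.RandomPlanarGeometry.SAW.hexDomainSimplyConnected (Λ n) ∧ a n ∈ Literature.Probability.RandomPlanarGeometry.SAW.hexDomainBoundary (Λ n) ∧ ∀ w : Literature.Probability.LatticeModels.HexVertex, dist (Literature.Probability.LatticeModels.hexCenter w) (Literature.Probability.LatticeModels.hexCenter O) ≤ (n : ℝ) → w ∈ Λ n) ∧ (∀ n : ℕ, M (Λ n) (a n) ≠ 0) ∧ ∀ z ∈ Literature.Probability.LatticeModels.hexGraph.edgeSet,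 Filter.Tendsto (fun n : ℕ => F (Λ n) (a n) z / M (Λ n) (a n)) Filter.atTop (nhds (G z))}; LocalLimits.Subsingleton) ↔ Summit.CriticalPhenomena.SAWScalingLimit.Theses.SAWDevelopingMap.InteriorFlattening :=
  ⟨InteriorFlattening_of h₁, fun h => (subs_of_InteriorFlattening h).2⟩

/-- stub 2 implies uniqueness of PICTURE-DOMAIN limits (the far-field-free sub-family; …LiouvillePicSubLocal) — the first
stub of any line on child 2 (S7 `stub_uniquenessReduction` cuts child 2 into picture limits + windowed far-field coherence +
intrusion tail under stub 1). -/
theorem picLimits_subsingleton_of_stub_localLimitsUnique (h₂ : let O : Literature.Probability.LatticeModels.HexVertex := ((0 : Literature.Probability.LatticeModels.Site 2), (0 : Fin 2)); let A : Literature.Probability.LatticeModels.HexVertex := ((0 : Literature.Probability.LatticeModels.Site 2), (1 : Fin 2)); let B : Literature.Probability.LatticeModels.HexVertex := ((-(Pi.single 0 1) : Literature.Probability.LatticeModels.Site 2), (1 : Fin 2)); let C : Literature.Probability.LatticeModels.HexVertex := ((-(Pi.single 1 1) : Literature.Probability.LatticeModels.Site 2), (1 : Fin 2)); let F : Finset Literature.Probability.LatticeModels.HexVertex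 → Sym2 Literature.Probability.LatticeModels.HexVertex → Sym2 Literature.Probability.LatticeModels.HexVertex → ℂ := fun Λ a z => Literature.Probability.RandomPlanarGeometry.SAW.hexParafermionicObservable Λ a Literature.Probability.RandomPlanarGeometry.SAW.hexCriticalFugacity (5 / 8) z; let M : Finset Literature.Probability.LatticeModels.HexVertex → Sym2 Literature.Probability.LatticeModels.HexVertex → ℂ := fun Λ a => F Λ a s(O, A) + F Λ a s(O, B) + F Λ a s(O, C); let LocalLimits : Set (Sym2 Literature.Probability.LatticeModels.HexVertex → ℂ) := {G | (∀ z : Sym2 Literature.Probability.LatticeModels.HexVertex, z ∉ Literature.Probability.LatticeModels.hexGraph.edgeSet → G z = 0) ∧ ∃ (Λ : ℕ → Finset Literature.Probability.LatticeModels.HexVertex) (a : ℕ → Sym2 Literature.Probability.LatticeModels.HexVertex), (∀ n : ℕ, Literature.Probability.RandomPlanarGeometry.SAW.hexDomainSimplyConnected (Λ n) ∧ a n ∈ Literature.Probability.RandomPlanarGeometry.SAW.hexDomainBoundary (Λ n) ∧ ∀ w : Literature.Probability.LatticeModels.HexVertex, dist (Literature.Probability.LatticeModels.hexCenter w) (Literature.Probability.LatticeModels.hexCenter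 O) ≤ (n : ℝ) → w ∈ Λ n) ∧ (∀ n : ℕ, M (Λ n) (a n) ≠ 0) ∧ ∀ z ∈ Literature.Probability.LatticeModels.hexGraph.edgeSet, Filter.Tendsto (fun n : ℕ => F (Λ n) (a n) z / M (Λ n) (a n)) Filter.atTop (nhds (G z))}; LocalLimits.Subsingleton) : PicLimits.Subsingleton :=
  picLimits_subsingleton_of_localLimits_subsingleton (stub_localLimitsUnique_iff_defs.1 h₂)

/-- The crux from the two registered stubs (documentation of closure; carries the two sorries). -/
theorem InteriorFlattening_of_stubs :
    Summit.CriticalPhenomena.SAWScalingLimit.Theses.SAWDevelopingMap.InteriorFlattening :=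
  InteriorFlattening_of stub_bulkNoFold stub_localLimitsUnique

end Summit.CriticalPhenomena.SAWScalingLimit.Cruxes.InteriorFlattening.ExactSplit

end
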